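import Literature.AlgebraicGeometry.Motives.AlbaneseRationalCohomology
import Literature.AlgebraicGeometry.ComplexMultiplication.EndAlgebraCommSubalgebraDegreeBound
import HarnessLib

/-!
# Morphisms to an abelian variety non-trivial on `H¹` = non-zero homomorphisms from the Albanese

Topic `Literature/AlgebraicGeometry/Motives`, sequel of `AlbaneseExistenceComplex` /
`AlbaneseRationalCohomology` (the Albanese variety of a smooth projective complex variety in the tree's
point-free sense `Motives.Jacobian X`, and the injectivity of `(f^P)^*` on `H¹(−(ℂ); ℚ)`). PROOF FILE:
theorems only — no definition, no named fact, sorry-free (D-0026).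

Let `X` be a complex scheme with an Albanese datum `𝒥 : Jacobian X` and a point `P`, and `A/ℂ` an abelian
variety. Every morphism `F : X → A` is, up to the translation by `F(P)`, of the form `u_F ∘ f^P` for a unique
HOMOMORPHISM `u_F : Alb X → A` (Milne, *Jacobian Varieties* Prop. 6.1 = the tree's `Jacobian.descPointed`;
Bădescu Def. 5.2), and translations act trivially on cohomology, so `F^* = (f^P)^* ∘ u_F^*` on `H¹(−(ℂ); ℚ)`
(`Jacobian.bettiCohomology_map_eq_comp_abelJacobi`). This file turns that into the dictionary
**«`X` admits a morphism to `A` that is non-zero on `H¹(−; ℚ)` iff `Hom(Alb X, A) ≠ 0»**: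

* `Jacobian.hom_bettiCohomology_map_descPointed_ne_zero`, `Jacobian.descPointed_ne_zero` — if `F^* ≠ 0`
  on `H¹(−; ℚ)` then `u_F^* ≠ 0`, so `u_F ≠ 0` (the zero homomorphism kills `H¹`,
  `bettiCohomology_map_zero_one`);
* `Jacobian.hom_bettiCohomology_map_abelJacobi_comp_ne_zero` — for `X` smooth projective and a homomorphism
  `u : Alb X → A` with `u^* ≠ 0` on `H¹(−; ℚ)`, the MORPHISM `f^P ≫ u : X → A` has `(f^P ≫ u)^* ≠ 0`
  (`(f^P)^*` is injective on `H¹(−; ℚ)`, `Jacobian.injective_bettiCohomology_map_abelJacobi_one_of_dim`);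
  `Jacobian.hom_bettiCohomology_map_abelJacobi_comp_ne_zero_of_ne_zero` — the same for any `u ≠ 0`, by the
  FAITHFULNESS of the rational representation (`hom_eq_zero_of_bettiCohomology_map_one_eq_zero`,
  Lange–Birkenhake §1.1.2: the rational representation `ρ_r : Hom(X, X') → Hom_ℤ(Λ, Λ')` is injective);
* **`Jacobian.exists_hom_bettiCohomology_map_ne_zero_iff_exists_hom_ne_zero`** — for `X` smooth projective:
  `(∃ F : X → A, F^* ≠ 0 on H¹(−; ℚ)) ↔ (∃ u : Alb X → A, u ≠ 0)`; and the intermediate form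
  `Jacobian.exists_hom_bettiCohomology_map_ne_zero_iff` (`… ↔ ∃ u : Alb X → A, u^* ≠ 0`), which does not use
  faithfulness.

Consumer: the Hodge-CM cell's junction B01 in the normal form `Universe.FaceAlbaneseReach`
(`Summits/HodgeConjecture/CorCM/B01/FaceSupplyAlbanese`: morphisms `P_Γ → A_{(F,ψ₀)}`, `P_Γ → A_{(F,ψ₁)}`
non-zero on `H¹(−, ℚ)`), which thereby reads «`Hom(Alb(P_Γ), A_{(F,ψᵢ)}) ≠ 0`» — the CM isogeny factors of
the Albanese of the Picard modular surface (Murty–Ramakrishnan 1992; Liu 2021 Cor. 4.20).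

## References

* [Milne1986JacobianVarieties] J. S. Milne, *Jacobian Varieties* (1986), §6 Prop. 6.1 (universal property).
* [Badescu2001] L. Bădescu, *Algebraic Surfaces* (2001), Ch. 5 Def. 5.2 / Thm. 5.3 (Albanese variety).
* [LangeBirkenhake1992] H. Lange, Ch. Birkenhake, *Complex Abelian Varieties* (1992), §1.1.2
  «Homomorphisms of Complex Tori» (p. 10): Prop. 1.1.6 and the injectivity of the rational representation
  `ρ_r`.
* [Voisin2002] C. Voisin, *Hodge Theory and Complex Algebraic Geometry I* (2002), Lemma 7.28.
* [Liu2021] Y. Liu, *Fourier–Jacobi cycles and arithmetic relative trace formula*, Camb. J. Math. 9 (2021),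
  Lemma 2.4 (1) and Cor. 4.20.
-/

noncomputable section

open CategoryTheory AlgebraicGeometry

namespace Literature.AlgebraicGeometry.Motives

open Literature.AlgebraicGeometry.ComplexMultiplication

namespace Jacobian

variable {X : SchemeOver ℂ} (𝒥 : Jacobian X) (P : AlgPoints X ℂ) (A : AbelianVariety ℂ)

/-! ### A morphism non-zero on `H¹` gives a homomorphism `Alb X → A` non-zero on `H¹` -/

/-- **If `F^* ≠ 0` on `H¹(−(ℂ); ℚ)` then `u_F^* ≠ 0`**, `u_F = descPointed P (F − F(P)) : Alb X → A` the
homomorphism of the universal property: `F^* = (f^P)^* ∘ u_F^*` (translations act trivially on `H¹`).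
[cite: Milne1986JacobianVarieties, §6 Prop. 6.1] [cite: Badescu2001, Ch. 5 Def. 5.2] -/
theorem hom_bettiCohomology_map_descPointed_ne_zero (F : X ⟶ A.X)
    (hF : (bettiCohomology.map F 1).hom ≠ 0) :
    (bettiCohomology.map
      (𝒥.descPointed P _ (Jacobian.point_comp_mul_const_inv P F)).hom.hom.hom 1).hom ≠ 0 := by
  intro h
  apply hF
  rw [𝒥.bettiCohomology_map_eq_comp_abelJacobi P F 1, ModuleCat.hom_comp, h, LinearMap.comp_zero]

/-- **If `F^* ≠ 0` on `H¹(−(ℂ); ℚ)` then the homomorphism `u_F : Alb X → A` is non-zero** — in particular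
`Hom(Alb X, A) ≠ 0` (the zero homomorphism kills `H¹`, `bettiCohomology_map_zero_one`).
[cite: Milne1986JacobianVarieties, §6 Prop. 6.1] [cite: LangeBirkenhake1992, §1.1.2 (ρ_r injective, after Prop. 1.1.6; p. 10)] -/
theorem descPointed_ne_zero (F : X ⟶ A.X) (hF : (bettiCohomology.map F 1).hom ≠ 0) :
    𝒥.descPointed P _ (Jacobian.point_comp_mul_const_inv P F) ≠ 0 := by
  intro h0
  apply 𝒥.hom_bettiCohomology_map_descPointed_ne_zero P A F hF
  rw [h0, bettiCohomology_map_zero_one]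
  rfl

include P in
/-- `F^* ≠ 0` on `H¹(−(ℂ); ℚ)` for some morphism `F : X → A` forces `Hom(Alb X, A) ≠ 0`.
[cite: Milne1986JacobianVarieties, §6 Prop. 6.1] [cite: LangeBirkenhake1992, §1.1.2 (ρ_r injective, after Prop. 1.1.6; p. 10)] -/
theorem exists_hom_ne_zero_of_hom_bettiCohomology_map_ne_zero (F : X ⟶ A.X)
    (hF : (bettiCohomology.map F 1).hom ≠ 0) : ∃ u : 𝒥.J ⟶ A, u ≠ 0 :=
  ⟨_, 𝒥.descPointed_ne_zero P A F hF⟩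

/-! ### Smooth projective `X`: a homomorphism `Alb X → A` non-zero on `H¹` gives such a morphism -/

variable {d : ℕ}

/-- **`(f^P ≫ u)^* ≠ 0` on `H¹(−(ℂ); ℚ)` for a homomorphism `u : Alb X → A` with `u^* ≠ 0`** (`X` smooth
projective): `(f^P ≫ u)^* = (f^P)^* ∘ u^*` and `(f^P)^*` is injective on `H¹(−(ℂ); ℚ)`
(`Jacobian.injective_bettiCohomology_map_abelJacobi_one_of_dim`, Voisin I Lemma 7.28 for the generating
morphism `f^P`). [cite: Voisin2002, Lemma 7.28] [cite: Milne1986JacobianVarieties, §6 Prop. 6.1] -/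
theorem hom_bettiCohomology_map_abelJacobi_comp_ne_zero (hX : IsSmoothProjective d X) (u : 𝒥.J ⟶ A)
    (hu : (bettiCohomology.map u.hom.hom.hom 1).hom ≠ 0) :
    (bettiCohomology.map (𝒥.abelJacobi P ≫ u.hom.hom.hom) 1).hom ≠ 0 := by
  intro h
  apply hu
  rw [bettiCohomology.map_comp, ModuleCat.hom_comp] at h
  ext β
  have hβ := LinearMap.congr_fun h β
  rw [LinearMap.comp_apply, LinearMap.zero_apply] at hβ
  rw [LinearMap.zero_apply]
  exact 𝒥.injective_bettiCohomology_map_abelJacobi_one_of_dim hX P (hβ.trans (map_zero _).symm)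

/-- **`(f^P ≫ u)^* ≠ 0` on `H¹(−(ℂ); ℚ)` for every NON-ZERO homomorphism `u : Alb X → A`** (`X` smooth
projective): the rational representation is faithful (`hom_eq_zero_of_bettiCohomology_map_one_eq_zero`),
so `u^* ≠ 0`. [cite: LangeBirkenhake1992, §1.1.2 (ρ_r injective, after Prop. 1.1.6; p. 10)] [cite: Voisin2002, Lemma 7.28] -/
theorem hom_bettiCohomology_map_abelJacobi_comp_ne_zero_of_ne_zero (hX : IsSmoothProjective d X)
    (u : 𝒥.J ⟶ A) (hu : u ≠ 0) :
    (bettiCohomology.map (𝒥.abelJacobi P ≫ u.hom.hom.hom) 1).hom ≠ 0 :=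
  𝒥.hom_bettiCohomology_map_abelJacobi_comp_ne_zero P A hX u
    fun h => hu (hom_eq_zero_of_bettiCohomology_map_one_eq_zero u h)

/-! ### The dictionary -/

/-- **`X` admits a morphism to `A` non-zero on `H¹(−; ℚ)` iff some homomorphism `Alb X → A` is non-zero on
`H¹(−; ℚ)`** (`X` smooth projective; no faithfulness needed).
[cite: Milne1986JacobianVarieties, §6 Prop. 6.1] [cite: Voisin2002, Lemma 7.28] -/
theorem exists_hom_bettiCohomology_map_ne_zero_iff (hX : IsSmoothProjective d X) :
    (∃ F : X ⟶ A.X, (bettiCohomology.map F 1).hom ≠ 0) ↔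
      ∃ u : 𝒥.J ⟶ A, (bettiCohomology.map u.hom.hom.hom 1).hom ≠ 0 := by
  obtain ⟨P⟩ := hX.nonempty_algPoints ℂ
  exact ⟨fun ⟨F, hF⟩ => ⟨_, 𝒥.hom_bettiCohomology_map_descPointed_ne_zero P A F hF⟩,
    fun ⟨u, hu⟩ => ⟨_, 𝒥.hom_bettiCohomology_map_abelJacobi_comp_ne_zero P A hX u hu⟩⟩

/-- **`X` admits a morphism to `A` non-zero on `H¹(−; ℚ)` iff `Hom(Alb X, A) ≠ 0`** (`X` smooth
projective). In the Hodge-CM application (`X = P_Γ` a Picard modular surface, `A = A_{(F,ψ)}` a CM abelian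
variety): the supply input of junction B01 in the normal form `FaceAlbaneseReach` reads
«`Hom(Alb(P_Γ), A_{(F,ψ₀)}) ≠ 0` and `Hom(Alb(P_Γ), A_{(F,ψ₁)}) ≠ 0` at some level» — `A_{(F,ψᵢ)}` meets the
Albanese of `P_Γ` (Murty–Ramakrishnan; Liu 2021 Cor. 4.20).
[cite: Milne1986JacobianVarieties, §6 Prop. 6.1] [cite: LangeBirkenhake1992, §1.1.2 (ρ_r injective, after Prop. 1.1.6; p. 10)]
[cite: Liu2021, Lemma 2.4 (1) and Cor. 4.20] -/
theorem exists_hom_bettiCohomology_map_ne_zero_iff_exists_hom_ne_zero (hX : IsSmoothProjective d X) :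
    (∃ F : X ⟶ A.X, (bettiCohomology.map F 1).hom ≠ 0) ↔ ∃ u : 𝒥.J ⟶ A, u ≠ 0 := by
  obtain ⟨P⟩ := hX.nonempty_algPoints ℂ
  exact ⟨fun ⟨F, hF⟩ => ⟨_, 𝒥.descPointed_ne_zero P A F hF⟩,
    fun ⟨u, hu⟩ => ⟨_, 𝒥.hom_bettiCohomology_map_abelJacobi_comp_ne_zero_of_ne_zero P A hX u hu⟩⟩

/-- Contrapositive form: **every morphism `X → A` kills `H¹(−; ℚ)` iff `Hom(Alb X, A) = 0`** (`X` smooth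
projective). [cite: Milne1986JacobianVarieties, §6 Prop. 6.1] [cite: LangeBirkenhake1992, §1.1.2 (ρ_r injective, after Prop. 1.1.6; p. 10)] -/
theorem forall_hom_bettiCohomology_map_eq_zero_iff_forall_hom_eq_zero (hX : IsSmoothProjective d X) :
    (∀ F : X ⟶ A.X, (bettiCohomology.map F 1).hom = 0) ↔ ∀ u : 𝒥.J ⟶ A, u = 0 := by
  have h := not_congr (𝒥.exists_hom_bettiCohomology_map_ne_zero_iff_exists_hom_ne_zero A hX)
  simp only [not_exists, not_not] at h
  exact h

end Jacobian

end Literature.AlgebraicGeometry.Motives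

end
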